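import Mathlib
import Literature.Probability.RandomPlanarGeometry.ChordalCurveFamily
import Literature.Topology.PlaneTopology.JordanCurve
import Literature.Topology.PlaneTopology.Crosscut
import Literature.Probability.RandomPlanarGeometry.ChordalCurveFamilyProofs
import HarnessLib

/-!
# A slit domain is not a Jordan carrier

Crux `AxiomsOfLimit` (stmt-CriticalPhenomena-1370), line `registered`, stub `stub_markovOfLimit`:
domain bookkeeping brick D2' "a slit domain is not a Jordan carrier" (lead c4); registered
sub-stub `stub_slitNotJordan`. Theorems only.

Let `(D₂; a₂, b₂)` be a Dobrushin domain and `p₂` a typical proper past: the class of a simple arc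
`γ` from the marked point `a₂ = D₂.pt 0` whose other points lie in the open carrier. Assuming the
connectivity of arc complements (hypothesis `hArc`, the neighbouring stub
`stub_arcComplementConnected`), the remaining domain `U := remainingDomain D₂ p₂` is the slit
domain `D₂ ∖ γ[0, 1]`, and it is the carrier of NO Dobrushin (Jordan) domain `D`.

## The argument

Suppose `U = D.carrier`. Put `K := γ[0, 1]`, `J := ∂D`, `J₂ := ∂D₂` (two Jordan curves).
* `U = D₂ ∖ K`: by `hArc` the set `D₂ ∖ K` is connected, and `b₂` lies in its closure (`b₂ ∉ K`,
  `K` closed, `b₂ ∈ D̄₂`).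
* `J₂ ⊆ J`: a point `x ∈ J₂` other than `a₂` is off the closed set `K` and in `D̄₂`, hence in the
  closure of `D₂ ∖ K = U`, and not in the open set `U ⊆ D₂`; so `x ∈ Ū ∖ U = ∂U = J`. The base
  point `a₂ = D₂.boundary m₀` is the limit of the boundary points `D₂.boundary s`, `s ↓ m₀`, all
  different from `a₂` (injectivity on a period), and `J` is closed.
* `J` meets `D₂`: `U` is a non-empty open subset of the connected open set `D₂`, proper since the
  tip `γ 1 ∈ D₂ ∩ K`; so `∂U` meets `D₂`. As `D₂ ∩ J₂ = ∅`, `J₂ ⊊ J`.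
* **A Jordan curve contains no other Jordan curve** (`SlitNotJordan.eq_of_subset`): if
  `J₂ ⊊ J` with both homeomorphic to the circle `ℝ/ℤ`, pick `q ∈ J ∖ J₂` with circle parameter
  `↑s₀`; the parameter map `equivIco 1 s₀ : ℝ/ℤ → [s₀, s₀ + 1)` is continuous off `↑s₀`, so
  `J₂ ↪ J ∖ {q} → ℝ` is a continuous injection, and composing with `ℝ/ℤ ≃ₜ J₂` gives a continuous
  injection of the circle into the line — impossible by the one-dimensional Borsuk–Ulam argument
  (`SlitNotJordan.not_injective_of_continuous`: `θ ↦ h θ - h (θ + 1/2)` changes sign on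
  `[0, 1/2]`).

References: folklore plane topology (e.g. J. McCleary, *A First Course in Topology* (2006),
Ch. 9). All [folklore].
-/

noncomputable section

open Filter Topology Set Metric

namespace Summit.CriticalPhenomena.SAWScalingLimit.Theorems.AxiomsOfLimitMarkov

open Literature.Probability.RandomPlanarGeometry Literature.Topology.PlaneTopology

/-- **One-dimensional Borsuk–Ulam: the circle `ℝ/ℤ` admits no continuous injection into the
line.** For continuous `h : ℝ/ℤ → ℝ` the function `θ ↦ h θ - h (θ + 1/2)` takes opposite values
at `0` and `1/2`, so it vanishes somewhere on `[0, 1/2]`, giving two antipodal (distinct)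
parameters with the same value. [folklore] -/
theorem SlitNotJordan.not_injective_of_continuous {h : AddCircle (1 : ℝ) → ℝ}
    (hc : Continuous h) : ¬ Function.Injective h := by
  intro hinj
  haveI : Fact ((0 : ℝ) < 1) := ⟨one_pos⟩
  set F : ℝ → ℝ := fun θ => h (θ : AddCircle (1 : ℝ)) - h ((θ + 1 / 2 : ℝ) : AddCircle (1 : ℝ))
    with hF
  have hmk : Continuous fun θ : ℝ => (θ : AddCircle (1 : ℝ)) := continuous_quotient_mk'
  have hFc : Continuous F :=
    (hc.comp hmk).sub (hc.comp (hmk.comp (continuous_id.add continuous_const)))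
  have hhalf : F (1 / 2) = -F 0 := by
    have h1 : ((1 / 2 + 1 / 2 : ℝ) : AddCircle (1 : ℝ)) = ((0 : ℝ) : AddCircle (1 : ℝ)) := by
      rw [show (1 / 2 + 1 / 2 : ℝ) = 0 + 1 by norm_num, AddCircle.coe_add_period]
    simp only [hF, h1, zero_add]
    ring
  obtain ⟨θ₀, -, hθ₀⟩ : ∃ θ₀ ∈ Icc (0 : ℝ) (1 / 2), F θ₀ = 0 := by
    rcases le_total (F 0) 0 with h0 | h0
    · exact intermediate_value_Icc (by norm_num) hFc.continuousOn ⟨h0, by rw [hhalf]; linarith⟩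
    · exact intermediate_value_Icc' (by norm_num) hFc.continuousOn ⟨by rw [hhalf]; linarith, h0⟩
  have heq : (θ₀ : AddCircle (1 : ℝ)) = ((θ₀ + 1 / 2 : ℝ) : AddCircle (1 : ℝ)) :=
    hinj (sub_eq_zero.1 hθ₀)
  have hx : θ₀ ∈ Ico θ₀ (θ₀ + 1) := left_mem_Ico.2 (by linarith)
  have hy : θ₀ + 1 / 2 ∈ Ico θ₀ (θ₀ + 1) := ⟨by linarith, by linarith⟩
  rw [AddCircle.coe_eq_coe_iff_of_mem_Ico hx hy] at heq
  linarith

/-- **A Jordan curve contains no other Jordan curve**: if `J₂ ⊆ J ⊆ ℂ` are both homeomorphic to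
the circle `ℝ/ℤ`, then `J₂ = J`. Otherwise a point `q ∈ J ∖ J₂` with circle parameter `↑s₀` is
removed; the parameter map `ℝ/ℤ → [s₀, s₀ + 1)` is continuous off `↑s₀`, so `J₂` injects
continuously into `ℝ`, and so would the circle. [folklore] -/
theorem SlitNotJordan.eq_of_subset {J J₂ : Set ℂ} (hJ : Nonempty (AddCircle (1 : ℝ) ≃ₜ J))
    (hJ₂ : Nonempty (AddCircle (1 : ℝ) ≃ₜ J₂)) (hsub : J₂ ⊆ J) : J₂ = J := by
  haveI : Fact ((0 : ℝ) < 1) := ⟨one_pos⟩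
  by_contra hne
  obtain ⟨q, hqJ, hqJ₂⟩ : ∃ q ∈ J, q ∉ J₂ := by
    by_contra h
    exact hne (hsub.antisymm fun q hq => by_contra fun hq₂ => h ⟨q, hq, hq₂⟩)
  obtain ⟨e⟩ := hJ
  obtain ⟨e₂⟩ := hJ₂
  obtain ⟨s₀, hs₀⟩ : ∃ s₀ : ℝ, (s₀ : AddCircle (1 : ℝ)) = e.symm ⟨q, hqJ⟩ :=
    QuotientAddGroup.mk_surjective _
  -- the parameter in `[s₀, s₀ + 1)` of a point of `J₂ ⊆ J`
  set ι : AddCircle (1 : ℝ) → AddCircle (1 : ℝ) := fun t => e.symm ⟨(e₂ t : ℂ), hsub (e₂ t).2⟩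
    with hι
  have hιc : Continuous ι :=
    e.symm.continuous.comp ((continuous_subtype_val.comp e₂.continuous).subtype_mk _)
  have hιne : ∀ t, ι t ≠ (s₀ : AddCircle (1 : ℝ)) := fun t ht => by
    rw [hι, hs₀, e.symm.injective.eq_iff] at ht
    have hq : (e₂ t : ℂ) = q := congrArg Subtype.val ht
    exact hqJ₂ (hq ▸ (e₂ t).2)
  set g : AddCircle (1 : ℝ) → ℝ := fun t => (AddCircle.equivIco 1 s₀ (ι t) : ℝ) with hg
  have hgc : Continuous g := by
    refine continuous_iff_continuousAt.2 fun t => ?_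
    exact (continuousAt_subtype_val.comp (AddCircle.continuousAt_equivIco 1 s₀ (hιne t))).comp
      hιc.continuousAt
  have hginj : Function.Injective g := by
    intro t₁ t₂ h
    have h1 : ι t₁ = ι t₂ := (AddCircle.equivIco 1 s₀).injective (Subtype.ext h)
    have h2 := e.symm.injective h1
    exact e₂.injective (Subtype.ext (Subtype.mk.inj h2))
  exact SlitNotJordan.not_injective_of_continuous hgc hginj

/-- **A slit domain is not a Jordan carrier.** Assume arc complements in Jordan domains are
connected (`hArc`). For a Dobrushin domain `D₂` and a typical proper past `p₂` (the class of a
simple arc from `D₂.pt 0` with all other points, in particular its tip, inside `D₂`), the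
remaining domain `remainingDomain D₂ p₂` is not the carrier of any Dobrushin domain `D`: its
frontier would be a Jordan curve containing the Jordan curve `∂D₂` together with a point of the
slit inside `D₂`, and a Jordan curve contains no other Jordan curve. [folklore] -/
theorem stub_slitNotJordan :
    (∀ (D : Literature.Probability.RandomPlanarGeometry.JordanDomain) (γ : Literature.Probability.RandomPlanarGeometry.Curve ℂ), Function.Injective γ → γ 0 ∈ frontier D.carrier → (∀ t : unitInterval, t ≠ 0 → γ t ∈ D.carrier) → IsConnected (D.carrier \ γ.range)) → ∀ (D D₂ : Literature.Probability.RandomPlanarGeometry.DobrushinDomain) (p₂ : Literature.Probability.RandomPlanarGeometry.CurveClass ℂ), ((∃ γ : Literature.Probability.RandomPlanarGeometry.Curve ℂ, Function.Injective γ ∧ Literature.Probability.RandomPlanarGeometry.CurveClass.mk γ = p₂) ∧ (p₂).source = (D₂).pt 0 ∧ (p₂).target ∈ (D₂).carrier ∧ (∀ z ∈ (p₂).range, z ≠ (D₂).pt 0 → z ∈ (D₂).carrier)) → Literature.Probability.RandomPlanarGeometry.remainingDomain D₂ p₂ ≠ D.carrier := by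
  intro hArc D D₂ p₂ hTS hEq
  obtain ⟨⟨γ, hγinj, rfl⟩, hsrc, htgt, hin⟩ := hTS
  rw [CurveClass.source_mk, Curve.source_def] at hsrc
  rw [CurveClass.target_mk, Curve.target_def] at htgt
  rw [CurveClass.range_mk] at hin
  set K : Set ℂ := γ.range with hK
  -- (0) elementary facts on the slit `K`
  have hKc : IsClosed K := γ.isCompact_range.isClosed
  have hnotfr : ∀ x ∈ D₂.carrier, x ∉ frontier D₂.carrier := fun x hx hfr =>
    hfr.2 (by rwa [D₂.isOpen.interior_eq])
  have hmemD : ∀ t : unitInterval, t ≠ 0 → γ t ∈ D₂.carrier := fun t ht =>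
    hin (γ t) ⟨t, rfl⟩ fun h => ht (hγinj (h.trans hsrc.symm))
  have hfrK : ∀ x ∈ frontier D₂.carrier, x ≠ D₂.pt 0 → x ∉ K := fun x hx hxa hxK =>
    hnotfr x (hin x hxK hxa) hx
  have hclK : ∀ x ∈ closure D₂.carrier, x ∉ K → x ∈ closure (D₂.carrier \ K) :=
    fun x hx hxK => by
    have := hKc.isOpen_compl.inter_closure ⟨hxK, hx⟩
    rwa [Set.sdiff_eq_compl_inter]
  -- the slit complement is connected (hypothesis `hArc`)
  have hconn : IsConnected (D₂.carrier \ K) :=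
    hArc D₂.toJordanDomain γ hγinj (hsrc ▸ D₂.pt_mem_frontier 0) hmemD
  -- the remaining domain is the whole slit complement
  have hb : D₂.pt 1 ∈ closure (D₂.carrier \ K) :=
    hclK _ (frontier_subset_closure (D₂.pt_mem_frontier 1))
      (hfrK _ (D₂.pt_mem_frontier 1) fun h => absurd (D₂.pt_injective h) (by decide))
  have hUeq : remainingDomain D₂ (CurveClass.mk γ) = D₂.carrier \ K := by
    refine (remainingDomain_subset D₂ _).antisymm fun z hz => ⟨hz, ?_⟩
    have hcc : connectedComponentIn (D₂.carrier \ K) z = D₂.carrier \ K :=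
      (connectedComponentIn_subset _ _).antisymm
        (hconn.isPreconnected.subset_connectedComponentIn hz Subset.rfl)
    show D₂.pt 1 ∈ closure (connectedComponentIn (D₂.carrier \ K) z)
    rw [hcc]
    exact hb
  have hDU : D.carrier = D₂.carrier \ K := hEq.symm.trans hUeq
  -- (1) the Jordan curve `∂D₂` lies on `∂D`
  have h1 : ∀ x ∈ frontier D₂.carrier, x ≠ D₂.pt 0 → x ∈ frontier D.carrier := fun x hx hxa => by
    rw [D.isOpen.frontier_eq, hDU]
    exact ⟨hclK x (frontier_subset_closure hx) (hfrK x hx hxa), fun hxD => hnotfr x hxD.1 hx⟩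
  have hJ₂J : frontier D₂.carrier ⊆ frontier D.carrier := by
    intro x hx
    rcases ne_or_eq x (D₂.pt 0) with hxa | hxa
    · exact h1 x hx hxa
    rw [hxa]
    -- the base point is a limit of other boundary points, and `∂D` is closed
    refine isClosed_frontier.mem_of_tendsto (b := 𝓝[>] (D₂.mark 0))
      ((D₂.continuous_boundary.tendsto (D₂.mark 0)).mono_left nhdsWithin_le_nhds) ?_
    filter_upwards [Ioo_mem_nhdsGT (show D₂.mark 0 < D₂.mark 0 + 1 by linarith)] with s hs
    refine h1 _ (D₂.boundary_mem_frontier s) fun h => hs.1.ne' ?_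
    exact D₂.injOn_boundary_Ico (D₂.mark 0) (Ioo_subset_Ico_self hs)
      (left_mem_Ico.2 (by linarith)) h
  -- (2) `∂D` meets the open set `D₂`
  have hw : ∃ w ∈ D₂.carrier, w ∈ frontier D.carrier := by
    by_contra hno
    have hsub : D₂.carrier ⊆ D.carrier ∪ (closure D.carrier)ᶜ := fun w hw => by
      by_cases h : w ∈ closure D.carrier
      · refine Or.inl (by_contra fun hwD => hno ⟨w, hw, ?_⟩)
        rw [D.isOpen.frontier_eq]
        exact ⟨h, hwD⟩
      · exact Or.inr h
    rcases D₂.isConnected.isPreconnected.subset_or_subset D.isOpen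
      isClosed_closure.isOpen_compl (Set.disjoint_left.2 fun x hx hx' => hx' (subset_closure hx))
      hsub with h | h
    · -- the tip `γ 1 ∈ D₂ ∩ K` is not in `D = D₂ ∖ K`
      have := h htgt
      rw [hDU] at this
      exact this.2 ⟨1, rfl⟩
    · obtain ⟨v, hv⟩ := D.nonempty
      have hvD₂ : v ∈ D₂.carrier := by
        rw [hDU] at hv
        exact hv.1
      exact h hvD₂ (subset_closure hv)
  -- (3) two nested Jordan curves coincide: contradiction
  obtain ⟨w, hwD₂, hwJ⟩ := hw
  have hJ : Nonempty (AddCircle (1 : ℝ) ≃ₜ frontier D.carrier) := by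
    rw [← D.range_boundary]
    exact range_homeomorphic_addCircle D.continuous_boundary D.periodic_boundary D.injOn_boundary
  have hJ₂ : Nonempty (AddCircle (1 : ℝ) ≃ₜ frontier D₂.carrier) := by
    rw [← D₂.range_boundary]
    exact range_homeomorphic_addCircle D₂.continuous_boundary D₂.periodic_boundary
      D₂.injOn_boundary
  have hJeq : frontier D₂.carrier = frontier D.carrier := SlitNotJordan.eq_of_subset hJ hJ₂ hJ₂J
  exact hnotfr w hwD₂ (hJeq ▸ hwJ)

end Summit.CriticalPhenomena.SAWScalingLimit.Theorems.AxiomsOfLimitMarkov
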